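import Mathlib.Analysis.Distribution.TestFunction
import Summits.RiemannHypothesis.RiemannHypothesis.Theorems.SoloInformedWeilSurface

/-!
# AWS / Forcing — the forcing lemma of the arithmetic-Weil-surface sprint (cc-4)

(Filed under `Theorems/MotivicDoor/AWS/` because the filing seat is a planner; namespace
`Summit.RiemannHypothesis.MotivicDoor.AWS` as agreed for the sprint, so a later move of the file to
`Summits/RiemannHypothesis/MotivicDoor/AWS/Forcing.lean` changes no declaration name.)

HONEST LABEL (mandatory on every AWS file).  One-way implication from a strengthened,
prime-side-only axiom system; the existence of such an object is NOT claimed and is the located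
gap; the converse (RH ⇒ existence) is out of scope of the sprint's headline theorem (but see the
cc-4 design note `AWS-FORCING.md`, §Honesty: on the test class fixed here a TAUTOLOGICAL carrier
exists under Weil positivity, so the axiom list below is satisfiable iff RH — exactly as for the
typed carriers already in the tree, `WeilSurface.model`, `located_objects_tfae`).  Cell framing:
lottery ticket at the motivic door; RH probability negligible; consolation prizes are real: a new
semi-local Weil-positivity theorem, or a located gap in the Connes–Consani programme, plus the
ff-door theorem.

## What this file proves (all sorry-free; labels PROVED)

The sprint's target is `Nonempty ArithmeticWeilSurface → RiemannHypothesis`, where an arithmetic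
Weil surface (cc-3, `AWS/Structure.lean`) is a real vector space `V` of "divisor classes" with a
symmetric pairing `inter`, two isotropic fibre classes `e₁, e₂` with `inter e₁ e₂ = 1`, an
`ℝ`-LINEAR graph map `corr` from the TEST CLASS into `V`, intersection numbers prescribed ONLY on a
generating family `G` of tests and ONLY by prime-side data (polar terms and the Weil functional
`W = weilPolarTerm - weilPrimeTerm + weilArchTerm`, which contains no zero of `ζ`), a Hodge-index
sign axiom, and continuity of `u ↦ inter (corr u) x` in the test-class topology.  The FORCING
LEMMA is the step "identities on generators ⇒ identities for every test", after which
Castelnuovo–Severi (`inter_self_le_two_mul_of_perp`) gives `Re Q(u) ≥ 0` for real tests, i.e.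
Weil positivity (`weilPositivity_iff_real`), i.e. RH (`weil_criterion_holds`, Bombieri 2000 Thm 2).

* TEST CLASS = Mathlib's `𝓓((⊤ : Opens ℝ), ℝ)` (`TestFunction`: real-valued, smooth, compactly
  supported functions on `ℝ` with the canonical LF topology, `TestFunction.topologicalSpace`;
  universal property `TestFunction.continuous_iff_continuous_comp`).  Its elements complexify to
  Weil tests (`isWeilTest_coe`), and every real Weil test is one of its elements (`exists_test_coe_eq`).
* §1 ABSTRACT FORCING (`linearMap_apply_eq_of_denseSpan`, `bilin_apply_eq_of_denseSpan`,
  `bilin_apply_eq_of_denseSpan_of_symm`): over any topological `ℝ`-module `M`, two continuous linear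
  functionals, resp. two separately continuous bilinear forms, that agree on a set `G`, resp. on
  `G × G`, with `Dense (Submodule.span ℝ G)` agree everywhere.  The only Mathlib input is
  `ContinuousLinearMap.ext_on` (= `LinearMap.eqOn_span'` + `Set.EqOn.closure`).
* §2 SURFACE FORM (`inter_corr_corr_eq_of_generators`, `inter_corr_pt_eq_of_generators`): the same
  for `u v ↦ inter (corr u) (corr v)` and `u ↦ inter (corr u) x` with `corr : M →ₗ[ℝ] V` linear.
* §3 THE FORCING LEMMA in hypothesis form on the Weil test class (`weilForm_eq_of_generators`):
  if the prime-side packaging `𝔴 u v = Re W(u ⋆ ṽ)`, `m₀ u = Re û(0)`, `m₁ u = Re û(1)` is given by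
  continuous (in `u`) linear maps, the surface side `u ↦ inter (corr u) (corr v)`, `u ↦ inter (corr u) eᵢ`
  is continuous, and the three identities hold on generators `G` with dense span, then for EVERY
  test `u`: `inter (corr u) e₁ = Re û(1)`, `inter (corr u) e₂ = Re û(0)` and
  `inter (corr u) (corr u) = 2 Re û(0) Re û(1) - Re Q(u)` — literally the three graph axioms of the
  tree's `WeilSurface` (T53).  The structure-facing one-liner
  `weilForm_eq_of_arithmeticWeilSurface X := weilForm_eq_of_generators X.inter … X.gen_self …` is
  written in `AWS/Statement.lean`/`AWS/Chain.lean` once cc-3's field names are fixed; this file is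
  deliberately structure-agnostic so that it cannot drift from them.
* §4 CHAIN CERTIFICATE (`riemannHypothesis_of_generators`): the same hypotheses plus
  `inter e₁ e₁ = inter e₂ e₂ = 0`, `inter e₁ e₂ = 1` and Hodge-index negativity on `span(e₁,e₂)^⊥`
  imply `RiemannHypothesis`.  This is the design certificate that the sprint's axiom list closes;
  lad-1's `AWS/Chain.lean` restates it over the structure.

## What is NOT in this file (the two analytic inputs, owned by aws-1/aws-3, enter as hypotheses)

(DOWN-1) the packaging: `u v ↦ Re W(u ⋆ ṽ)` IS bilinear and `u ↦ Re û(0), Re û(1)` ARE linear on the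
test class (tree: `weilFunctional_add`, `weilFunctional_const_mul`, `weilConv_const_mul_left/right`,
`weilMellin_add`, `weilMellin_smul_real`; symmetry is PROVED here from
`weilFunctional_weilConv_weilReflect_swap_of_real`); (DOWN-2) CONTINUITY of `u ↦ Re W(u ⋆ ṽ)` and of
`u ↦ Re û(0), Re û(1)` in the LF topology — an analytic ESTIMATE (prime sum finite on each `𝓓_K`,
polar terms bounded by `‖u‖_∞ · |K| · e^{|K|}`, archimedean digamma integral bounded by two `C^k`
seminorms), to be stated and proved as lemmas in `AWS/ForcingDown.lean`, not waved through as
"standard" (REFEREE-1 D26 (c)).  (UP) `Dense (Submodule.span ℝ G)` for the chosen generating family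
is `AWS/ForcingUp.lean`.

References: A. Weil, *Sur les courbes algébriques …* (1948); E. Bombieri, Rend. Mat. Acc. Lincei (9)
11 (2000) Thm 2; A. Connes, C. Consani, arXiv:1805.10501 §3.1; N. Bourbaki, EVT II §4 no. 4 (inductive
limits of locally convex spaces); L. Schwartz, *Théorie des distributions* I §III.1 (the space `𝓓`).
-/

noncomputable section

open Complex Set TopologicalSpace Literature.NumberTheory.LFunctions
open Summit.RiemannHypothesis.RiemannHypothesis.Theorems
open scoped ComplexConjugate Distributions ContDiff

namespace Summit.RiemannHypothesis.MotivicDoor.AWS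

/-! ## §1 Abstract forcing: dense span + continuity -/

section Abstract

variable {M : Type*} [AddCommGroup M] [Module ℝ M] [TopologicalSpace M]

/-- Two continuous linear functionals on a topological `ℝ`-module that agree on a set `G` whose span is
dense agree everywhere (`ContinuousLinearMap.ext_on`). -/
theorem linearMap_apply_eq_of_denseSpan {G : Set M} (hG : Dense (Submodule.span ℝ G : Set M))
    (f g : M →ₗ[ℝ] ℝ) (hf : Continuous f) (hg : Continuous g) (h : ∀ φ ∈ G, f φ = g φ) (u : M) :
    f u = g u := by
  have key := ContinuousLinearMap.ext_on hG (f := ⟨f, hf⟩) (g := ⟨g, hg⟩) fun x hx ↦ h x hx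
  exact DFunLike.congr_fun key u

/-- Two bilinear forms on a topological `ℝ`-module, each continuous in each variable separately, that
agree on `G × G` for a set `G` with dense span agree everywhere. -/
theorem bilin_apply_eq_of_denseSpan {G : Set M} (hG : Dense (Submodule.span ℝ G : Set M))
    (P Q : M →ₗ[ℝ] M →ₗ[ℝ] ℝ)
    (hPl : ∀ v, Continuous fun u ↦ P u v) (hPr : ∀ u, Continuous fun v ↦ P u v)
    (hQl : ∀ v, Continuous fun u ↦ Q u v) (hQr : ∀ u, Continuous fun v ↦ Q u v)
    (h : ∀ φ ∈ G, ∀ ψ ∈ G, P φ ψ = Q φ ψ) (u v : M) : P u v = Q u v := by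
  -- first slot: for a generator `ψ`, `P · ψ = Q · ψ` everywhere
  have step : ∀ ψ ∈ G, ∀ u, P u ψ = Q u ψ := fun ψ hψ u ↦
    linearMap_apply_eq_of_denseSpan hG (P.flip ψ) (Q.flip ψ) (hPl ψ) (hQl ψ)
      (fun φ hφ ↦ h φ hφ ψ hψ) u
  -- second slot: for fixed `u`, `P u ·` and `Q u ·` agree on `G`
  exact linearMap_apply_eq_of_denseSpan hG (P u) (Q u) (hPr u) (hQr u) (fun ψ hψ ↦ step ψ hψ u) v

/-- Symmetric version: two SYMMETRIC bilinear forms, continuous in the first variable for each fixed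
second variable, that agree on `G × G` for a set `G` with dense span agree everywhere. -/
theorem bilin_apply_eq_of_denseSpan_of_symm {G : Set M} (hG : Dense (Submodule.span ℝ G : Set M))
    (P Q : M →ₗ[ℝ] M →ₗ[ℝ] ℝ) (hPs : ∀ u v, P u v = P v u) (hQs : ∀ u v, Q u v = Q v u)
    (hP : ∀ v, Continuous fun u ↦ P u v) (hQ : ∀ v, Continuous fun u ↦ Q u v)
    (h : ∀ φ ∈ G, ∀ ψ ∈ G, P φ ψ = Q φ ψ) (u v : M) : P u v = Q u v := by
  refine bilin_apply_eq_of_denseSpan hG P Q hP (fun u ↦ ?_) hQ (fun u ↦ ?_) h u v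
  · simpa only [hPs] using hP u
  · simpa only [hQs] using hQ u

/-- The same, as an equality of bilinear maps. -/
theorem bilin_eq_of_denseSpan_of_symm {G : Set M} (hG : Dense (Submodule.span ℝ G : Set M))
    (P Q : M →ₗ[ℝ] M →ₗ[ℝ] ℝ) (hPs : ∀ u v, P u v = P v u) (hQs : ∀ u v, Q u v = Q v u)
    (hP : ∀ v, Continuous fun u ↦ P u v) (hQ : ∀ v, Continuous fun u ↦ Q u v)
    (h : ∀ φ ∈ G, ∀ ψ ∈ G, P φ ψ = Q φ ψ) : P = Q :=
  LinearMap.ext₂ fun u v ↦ bilin_apply_eq_of_denseSpan_of_symm hG P Q hPs hQs hP hQ h u v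

end Abstract

/-! ## §2 Surface form: a symmetric pairing pulled back along a linear graph map -/

section Surface

variable {M : Type*} [AddCommGroup M] [Module ℝ M] [TopologicalSpace M]
variable {V : Type*} [AddCommGroup V] [Module ℝ V]

/-- FORCING for the pairing of two graphs: if `inter` is symmetric, `corr` is linear,
`u ↦ inter (corr u) (corr v)` is continuous for every `v`, `P` is a symmetric bilinear form continuous
in its first variable, and `inter (corr φ) (corr ψ) = P φ ψ` for generators `φ, ψ ∈ G` with dense span,
then `inter (corr u) (corr v) = P u v` for ALL `u, v`. -/
theorem inter_corr_corr_eq_of_generators (inter : LinearMap.BilinForm ℝ V)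
    (hsymm : ∀ x y, inter x y = inter y x) (corr : M →ₗ[ℝ] V)
    {G : Set M} (hG : Dense (Submodule.span ℝ G : Set M))
    (hcont : ∀ v, Continuous fun u ↦ inter (corr u) (corr v))
    (P : M →ₗ[ℝ] M →ₗ[ℝ] ℝ) (hPs : ∀ u v, P u v = P v u) (hP : ∀ v, Continuous fun u ↦ P u v)
    (hgen : ∀ φ ∈ G, ∀ ψ ∈ G, inter (corr φ) (corr ψ) = P φ ψ) (u v : M) :
    inter (corr u) (corr v) = P u v :=
  bilin_apply_eq_of_denseSpan_of_symm hG (inter.compl₁₂ corr corr) P (fun _ _ ↦ hsymm _ _) hPs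
    hcont hP hgen u v

/-- FORCING for the pairing of a graph with a fixed class `x` (e.g. a fibre): if
`u ↦ inter (corr u) x` is continuous, `ℓ` is a continuous linear functional and
`inter (corr φ) x = ℓ φ` on generators with dense span, then `inter (corr u) x = ℓ u` for all `u`. -/
theorem inter_corr_pt_eq_of_generators (inter : LinearMap.BilinForm ℝ V) (corr : M →ₗ[ℝ] V)
    (x : V) {G : Set M} (hG : Dense (Submodule.span ℝ G : Set M))
    (hcont : Continuous fun u ↦ inter (corr u) x) (ℓ : M →ₗ[ℝ] ℝ) (hℓ : Continuous ℓ)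
    (hgen : ∀ φ ∈ G, inter (corr φ) x = ℓ φ) (u : M) : inter (corr u) x = ℓ u :=
  linearMap_apply_eq_of_denseSpan hG (inter.flip x ∘ₗ corr) ℓ hcont hℓ hgen u

/-- Hodge-index negativity on `(e₁ + e₂)^⊥` (the classical statement for the ample class
`H = e₁ + e₂`) implies negativity on the smaller space `span(e₁, e₂)^⊥` used below. -/
theorem hodge_perp_of_hodge_sum (inter : LinearMap.BilinForm ℝ V) {e₁ e₂ : V}
    (hodge : ∀ D, inter D (e₁ + e₂) = 0 → inter D D ≤ 0) (D : V) (h₁ : inter D e₁ = 0)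
    (h₂ : inter D e₂ = 0) : inter D D ≤ 0 :=
  hodge D (by rw [map_add, h₁, h₂, add_zero])

/-- **Castelnuovo–Severi from negativity on `span(e₁,e₂)^⊥`** (Weil 1948; Hartshorne V Ex. 1.9): if
`e₁, e₂` are isotropic with `inter e₁ e₂ = 1` and `inter D D ≤ 0` whenever `inter D e₁ = inter D e₂ = 0`,
then `inter Γ Γ ≤ 2 (inter Γ e₁) (inter Γ e₂)` for every `Γ` — negativity applied to
`Γ - (inter Γ e₂) • e₁ - (inter Γ e₁) • e₂`, which IS orthogonal to both fibres.  (The tree's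
`inter_self_le_two_mul_of_hodge` assumes negativity on the larger space `(e₁ + e₂)^⊥`.) -/
theorem inter_self_le_two_mul_of_perp (inter : LinearMap.BilinForm ℝ V)
    (hsymm : ∀ x y, inter x y = inter y x) {e₁ e₂ : V} (h₁ : inter e₁ e₁ = 0)
    (h₂ : inter e₂ e₂ = 0) (h₁₂ : inter e₁ e₂ = 1)
    (hodge : ∀ D, inter D e₁ = 0 → inter D e₂ = 0 → inter D D ≤ 0) (Γ : V) :
    inter Γ Γ ≤ 2 * inter Γ e₁ * inter Γ e₂ := by
  have h₂₁ : inter e₂ e₁ = 1 := by rw [hsymm, h₁₂]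
  have hs₁ : inter e₁ Γ = inter Γ e₁ := hsymm _ _
  have hs₂ : inter e₂ Γ = inter Γ e₂ := hsymm _ _
  have h := hodge (Γ - inter Γ e₂ • e₁ - inter Γ e₁ • e₂)
    (by
      simp only [map_sub, map_smul, LinearMap.sub_apply, LinearMap.smul_apply, smul_eq_mul, h₁, h₂₁]
      ring)
    (by
      simp only [map_sub, map_smul, LinearMap.sub_apply, LinearMap.smul_apply, smul_eq_mul, h₂, h₁₂]
      ring)
  simp only [map_sub, map_smul, LinearMap.sub_apply, LinearMap.smul_apply, smul_eq_mul, h₁, h₂,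
    h₁₂, h₂₁, hs₁, hs₂] at h
  nlinarith [h]

end Surface

/-! ## §3 The Weil test class `𝓓(ℝ, ℝ)` and the forcing lemma -/

section WeilTests

/-- THE TEST CLASS of the sprint: real-valued smooth compactly supported functions on `ℝ` with the
canonical LF topology — Mathlib's `TestFunction (⊤ : Opens ℝ) ℝ ⊤`, notation `𝓓((⊤ : Opens ℝ), ℝ)`
(local shorthand `𝓓ℝ` in this file; no new definition is introduced). -/
local notation "𝓓ℝ" => TestFunction (⊤ : Opens ℝ) ℝ (⊤ : ℕ∞)

/-- An element of the test class, complexified, is a Weil test function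
(`IsWeilTest = ContDiff ℝ ∞ ∧ HasCompactSupport`). -/
theorem isWeilTest_coe (u : 𝓓ℝ) : IsWeilTest fun t ↦ ((u t : ℝ) : ℂ) :=
  ⟨ofRealCLM.contDiff.comp u.contDiff, u.hasCompactSupport.comp_left (g := ofReal) ofReal_zero⟩

/-- The complexification of a real test is real: `conj u = u`. -/
theorem conj_coe (u : 𝓓ℝ) (t : ℝ) : conj ((u t : ℝ) : ℂ) = (u t : ℂ) :=
  conj_ofReal _

/-- Every real function whose complexification is a Weil test function IS an element of the test
class: the test class is exactly the real Weil tests (used to pass from `𝓓ℝ` to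
`weilPositivity_iff_real`). -/
theorem exists_test_coe_eq (u : ℝ → ℝ) (hu : IsWeilTest fun t ↦ (u t : ℂ)) :
    ∃ T : 𝓓ℝ, ⇑T = u := by
  have h₁ : ContDiff ℝ ∞ u := by
    have h := reCLM.contDiff.comp hu.1
    have hfun : (⇑reCLM ∘ fun t ↦ ((u t : ℝ) : ℂ)) = u := funext fun t ↦ by simp
    rwa [hfun] at h
  have h₂ : HasCompactSupport u := by
    have h := hu.2.comp_left (g := Complex.re) Complex.zero_re
    have hfun : (Complex.re ∘ fun t ↦ ((u t : ℝ) : ℂ)) = u := funext fun t ↦ by simp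
    rwa [hfun] at h
  exact ⟨⟨u, h₁, h₂, by simp⟩, rfl⟩

/-- SYMMETRY of the prime-side pairing is a theorem, not an axiom: for real tests
`Re W(u ⋆ ṽ) = Re W(v ⋆ ũ)` (`weilFunctional_weilConv_weilReflect_swap_of_real`; in fact the complex
values agree). -/
theorem re_weilFunctional_conv_symm (u v : 𝓓ℝ) :
    (weilFunctional (weilConv (fun t ↦ ((u t : ℝ) : ℂ)) (weilReflect fun t ↦ ((v t : ℝ) : ℂ)))).re =
      (weilFunctional (weilConv (fun t ↦ ((v t : ℝ) : ℂ)) (weilReflect fun t ↦ ((u t : ℝ) : ℂ)))).re := by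
  rw [weilFunctional_weilConv_weilReflect_swap_of_real (conj_coe v) (conj_coe u)]

/-- The prescribed intersection form of two graphs, `𝔭(u,v) = m₀ u · m₁ v + m₁ u · m₀ v - 𝔴(u,v)`
("bidegrees minus the Weil functional": the polarisation of `2 Re û(0) Re û(1) - Re Q(u)`), exists as
a bilinear map built from the packaging maps (no definition is introduced; only its values matter). -/
theorem exists_graphForm {M : Type*} [AddCommGroup M] [Module ℝ M] (𝔴 : M →ₗ[ℝ] M →ₗ[ℝ] ℝ)
    (m₀ m₁ : M →ₗ[ℝ] ℝ) :
    ∃ P : M →ₗ[ℝ] M →ₗ[ℝ] ℝ, ∀ u v, P u v = m₀ u * m₁ v + m₁ u * m₀ v - 𝔴 u v :=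
  ⟨(LinearMap.mul ℝ ℝ).compl₁₂ m₀ m₁ + (LinearMap.mul ℝ ℝ).compl₁₂ m₁ m₀ - 𝔴, fun u v ↦ by
    simp [LinearMap.compl₁₂_apply]⟩

variable {V : Type*} [AddCommGroup V] [Module ℝ V]

/-- **THE FORCING LEMMA, polarised form** (cc-4, AWS sprint).  Data: a symmetric pairing `inter` on a
real vector space `V`, an `ℝ`-linear graph map `corr` on the test class `𝓓ℝ`, and a generating family
`G` of tests with DENSE SPAN.  Prime-side packaging (aws-1/aws-3): linear maps `𝔴, m₀, m₁` with
`𝔴 u v = Re W(u ⋆ ṽ)`, `m₀ u = Re û(0)`, `m₁ u = Re û(1)`, continuous in `u`.  Surface-side continuity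
(a structure axiom): `u ↦ inter (corr u) (corr v)` continuous for every `v`.  Axiom ON GENERATORS ONLY:
`inter (corr φ) (corr ψ) = m₀ φ m₁ ψ + m₁ φ m₀ ψ - 𝔴 φ ψ` for `φ, ψ ∈ G`.  CONCLUSION: the pairing of
ANY two graphs is the prescribed prime-side number,
`inter (corr u) (corr v) = Re û(0) Re v̂(1) + Re û(1) Re v̂(0) - Re W(u ⋆ ṽ)`.
Proof: §1–§2 (`ContinuousLinearMap.ext_on` in each slot; symmetry of `Re W(u ⋆ ṽ)` is
`re_weilFunctional_conv_symm`). -/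
theorem inter_corr_corr_eq_of_weil_generators (inter : LinearMap.BilinForm ℝ V)
    (hsymm : ∀ x y, inter x y = inter y x) (corr : 𝓓ℝ →ₗ[ℝ] V) {G : Set 𝓓ℝ}
    (hG : Dense (Submodule.span ℝ G : Set 𝓓ℝ)) (𝔴 : 𝓓ℝ →ₗ[ℝ] 𝓓ℝ →ₗ[ℝ] ℝ) (m₀ m₁ : 𝓓ℝ →ₗ[ℝ] ℝ)
    (h𝔴 : ∀ u v, 𝔴 u v =
      (weilFunctional (weilConv (fun t ↦ ((u t : ℝ) : ℂ)) (weilReflect fun t ↦ ((v t : ℝ) : ℂ)))).re)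
    (hm₀ : ∀ u, m₀ u = (weilMellin (fun t ↦ ((u t : ℝ) : ℂ)) 0).re)
    (hm₁ : ∀ u, m₁ u = (weilMellin (fun t ↦ ((u t : ℝ) : ℂ)) 1).re)
    (h𝔴c : ∀ v, Continuous fun u ↦ 𝔴 u v) (hm₀c : Continuous m₀) (hm₁c : Continuous m₁)
    (hc : ∀ v, Continuous fun u ↦ inter (corr u) (corr v))
    (hgen : ∀ φ ∈ G, ∀ ψ ∈ G, inter (corr φ) (corr ψ) = m₀ φ * m₁ ψ + m₁ φ * m₀ ψ - 𝔴 φ ψ)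
    (u v : 𝓓ℝ) :
    inter (corr u) (corr v) =
      (weilMellin (fun t ↦ ((u t : ℝ) : ℂ)) 0).re * (weilMellin (fun t ↦ ((v t : ℝ) : ℂ)) 1).re +
      (weilMellin (fun t ↦ ((u t : ℝ) : ℂ)) 1).re * (weilMellin (fun t ↦ ((v t : ℝ) : ℂ)) 0).re -
      (weilFunctional (weilConv (fun t ↦ ((u t : ℝ) : ℂ)) (weilReflect fun t ↦ ((v t : ℝ) : ℂ)))).re := by
  obtain ⟨P, hP⟩ := exists_graphForm 𝔴 m₀ m₁
  have h𝔴s : ∀ u v, 𝔴 u v = 𝔴 v u := fun u v ↦ by rw [h𝔴, h𝔴, re_weilFunctional_conv_symm]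
  have hPs : ∀ u v, P u v = P v u := fun u v ↦ by rw [hP, hP, h𝔴s u v]; ring
  have hPc : ∀ v, Continuous fun u ↦ P u v := fun v ↦ by
    simp only [hP]
    exact ((hm₀c.mul continuous_const).add (hm₁c.mul continuous_const)).sub (h𝔴c v)
  rw [inter_corr_corr_eq_of_generators inter hsymm corr hG hc P hPs hPc
    (fun φ hφ ψ hψ ↦ by rw [hP]; exact hgen φ hφ ψ hψ) u v]
  simp only [hP, h𝔴, hm₀, hm₁]

/-- **THE FORCING LEMMA** (cc-4, AWS sprint; the statement `weilForm_eq_of_arithmeticWeilSurface`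
is this theorem applied to the structure's fields).  Under the hypotheses of
`inter_corr_corr_eq_of_weil_generators`, plus continuity of `u ↦ inter (corr u) eᵢ` and the fibre
axioms `inter (corr φ) e₁ = m₁ φ`, `inter (corr φ) e₂ = m₀ φ` on generators, EVERY test `u` satisfies
the three graph identities of a Weil surface (T53 `WeilSurface.inter_corr_e₁/e₂/self`):
`corr u · e₁ = Re û(1)`, `corr u · e₂ = Re û(0)`, `corr u · corr u = 2 Re û(0) Re û(1) - Re Q(u)`. -/
theorem weilForm_eq_of_generators (inter : LinearMap.BilinForm ℝ V)
    (hsymm : ∀ x y, inter x y = inter y x) (e₁ e₂ : V) (corr : 𝓓ℝ →ₗ[ℝ] V) {G : Set 𝓓ℝ}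
    (hG : Dense (Submodule.span ℝ G : Set 𝓓ℝ)) (𝔴 : 𝓓ℝ →ₗ[ℝ] 𝓓ℝ →ₗ[ℝ] ℝ) (m₀ m₁ : 𝓓ℝ →ₗ[ℝ] ℝ)
    (h𝔴 : ∀ u v, 𝔴 u v =
      (weilFunctional (weilConv (fun t ↦ ((u t : ℝ) : ℂ)) (weilReflect fun t ↦ ((v t : ℝ) : ℂ)))).re)
    (hm₀ : ∀ u, m₀ u = (weilMellin (fun t ↦ ((u t : ℝ) : ℂ)) 0).re)
    (hm₁ : ∀ u, m₁ u = (weilMellin (fun t ↦ ((u t : ℝ) : ℂ)) 1).re)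
    (h𝔴c : ∀ v, Continuous fun u ↦ 𝔴 u v) (hm₀c : Continuous m₀) (hm₁c : Continuous m₁)
    (hc : ∀ v, Continuous fun u ↦ inter (corr u) (corr v))
    (hc₁ : Continuous fun u ↦ inter (corr u) e₁) (hc₂ : Continuous fun u ↦ inter (corr u) e₂)
    (hgen : ∀ φ ∈ G, ∀ ψ ∈ G, inter (corr φ) (corr ψ) = m₀ φ * m₁ ψ + m₁ φ * m₀ ψ - 𝔴 φ ψ)
    (hgen₁ : ∀ φ ∈ G, inter (corr φ) e₁ = m₁ φ) (hgen₂ : ∀ φ ∈ G, inter (corr φ) e₂ = m₀ φ)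
    (u : 𝓓ℝ) :
    inter (corr u) e₁ = (weilMellin (fun t ↦ ((u t : ℝ) : ℂ)) 1).re ∧
    inter (corr u) e₂ = (weilMellin (fun t ↦ ((u t : ℝ) : ℂ)) 0).re ∧
    inter (corr u) (corr u) =
      2 * (weilMellin (fun t ↦ ((u t : ℝ) : ℂ)) 0).re * (weilMellin (fun t ↦ ((u t : ℝ) : ℂ)) 1).re -
        (weilQuadratic fun t ↦ ((u t : ℝ) : ℂ)).re := by
  refine ⟨?_, ?_, ?_⟩
  · rw [inter_corr_pt_eq_of_generators inter corr e₁ hG hc₁ m₁ hm₁c hgen₁ u, hm₁]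
  · rw [inter_corr_pt_eq_of_generators inter corr e₂ hG hc₂ m₀ hm₀c hgen₂ u, hm₀]
  · have hQ : (weilQuadratic fun t ↦ ((u t : ℝ) : ℂ)).re =
        (weilFunctional (weilConv (fun t ↦ ((u t : ℝ) : ℂ)) (weilReflect fun t ↦ ((u t : ℝ) : ℂ)))).re :=
      rfl
    rw [inter_corr_corr_eq_of_weil_generators inter hsymm corr hG 𝔴 m₀ m₁ h𝔴 hm₀ hm₁ h𝔴c hm₀c hm₁c
      hc hgen u u, hQ]
    ring

end WeilTests

/-! ## §4 Chain certificate: the axiom list closes to RH -/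

section Chain

local notation "𝓓ℝ" => TestFunction (⊤ : Opens ℝ) ℝ (⊤ : ℕ∞)

variable {V : Type*} [AddCommGroup V] [Module ℝ V]

/-- **DESIGN CERTIFICATE** (hypothesis form of `Nonempty ArithmeticWeilSurface → RiemannHypothesis`):
the forcing hypotheses of `weilForm_eq_of_generators`, the fibre numbers `e₁² = e₂² = 0`, `e₁·e₂ = 1`
and Hodge-index negativity on `span(e₁, e₂)^⊥` imply the Riemann Hypothesis.  Route: forcing ⇒ the
three graph identities for every real test ⇒ Castelnuovo–Severi `corr u · corr u ≤ 2 (corr u·e₁)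
(corr u·e₂)` (`inter_self_le_two_mul_of_perp`) ⇒ `Re Q(u) ≥ 0` for real tests (`exists_test_coe_eq`)
⇒ Weil positivity (`weilPositivity_iff_real`) ⇒ RH (`weil_criterion_holds`, Bombieri 2000 Thm 2).
No instance of the hypotheses is claimed. -/
theorem riemannHypothesis_of_generators (inter : LinearMap.BilinForm ℝ V)
    (hsymm : ∀ x y, inter x y = inter y x) (e₁ e₂ : V) (he₁ : inter e₁ e₁ = 0)
    (he₂ : inter e₂ e₂ = 0) (he₁₂ : inter e₁ e₂ = 1)
    (hodge : ∀ D, inter D e₁ = 0 → inter D e₂ = 0 → inter D D ≤ 0)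
    (corr : 𝓓ℝ →ₗ[ℝ] V) {G : Set 𝓓ℝ} (hG : Dense (Submodule.span ℝ G : Set 𝓓ℝ))
    (𝔴 : 𝓓ℝ →ₗ[ℝ] 𝓓ℝ →ₗ[ℝ] ℝ) (m₀ m₁ : 𝓓ℝ →ₗ[ℝ] ℝ)
    (h𝔴 : ∀ u v, 𝔴 u v =
      (weilFunctional (weilConv (fun t ↦ ((u t : ℝ) : ℂ)) (weilReflect fun t ↦ ((v t : ℝ) : ℂ)))).re)
    (hm₀ : ∀ u, m₀ u = (weilMellin (fun t ↦ ((u t : ℝ) : ℂ)) 0).re)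
    (hm₁ : ∀ u, m₁ u = (weilMellin (fun t ↦ ((u t : ℝ) : ℂ)) 1).re)
    (h𝔴c : ∀ v, Continuous fun u ↦ 𝔴 u v) (hm₀c : Continuous m₀) (hm₁c : Continuous m₁)
    (hc : ∀ v, Continuous fun u ↦ inter (corr u) (corr v))
    (hc₁ : Continuous fun u ↦ inter (corr u) e₁) (hc₂ : Continuous fun u ↦ inter (corr u) e₂)
    (hgen : ∀ φ ∈ G, ∀ ψ ∈ G, inter (corr φ) (corr ψ) = m₀ φ * m₁ ψ + m₁ φ * m₀ ψ - 𝔴 φ ψ)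
    (hgen₁ : ∀ φ ∈ G, inter (corr φ) e₁ = m₁ φ) (hgen₂ : ∀ φ ∈ G, inter (corr φ) e₂ = m₀ φ) :
    RiemannHypothesis := by
  refine (show RiemannHypothesis ↔ WeilPositivity from weil_criterion_holds).2
    (weilPositivity_iff_real.2 fun u hu ↦ ?_)
  obtain ⟨T, hT⟩ := exists_test_coe_eq u hu
  obtain ⟨h₁, h₂, hself⟩ := weilForm_eq_of_generators inter hsymm e₁ e₂ corr hG 𝔴 m₀ m₁ h𝔴 hm₀ hm₁
    h𝔴c hm₀c hm₁c hc hc₁ hc₂ hgen hgen₁ hgen₂ T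
  have hcs := inter_self_le_two_mul_of_perp inter hsymm he₁ he₂ he₁₂ hodge (corr T)
  rw [hself, h₁, h₂, hT] at hcs
  nlinarith [hcs]

end Chain

end Summit.RiemannHypothesis.MotivicDoor.AWS

end
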